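import Summits.ValiantsHypothesis.ValiantsHypothesis.Theorems.RigidityForcesSymmetryGrenetFirstOrderRankRigidWeightZero
import Summits.ValiantsHypothesis.ValiantsHypothesis.Theorems.RigidityForcesSymmetryGrenetFirstOrderRankRigidAddPotential

/-!
# Route RigidityForcesSymmetry — `GrenetFirstOrderRankRigid` (item stmt-ValiantsHypothesis-21029),
line `grenet_gauge`: stub `stub_linearRigid`, step 5 (block W0, part 2) — the arc entries of a
tangent direction are a potential difference

For the crux line `Cruxes/GrenetFirstOrderRankRigid/Lines/grenet_gauge.lean` (blueprint
`Lines/grenet_gauge-stub_linearRigid-PROOF.md`, §5, block W0).  The WEIGHT-ZERO block of the tangency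
identity of a homogeneous direction `Σ_v x_v A'_v` at Grenet's pencil consists of the ARC ENTRIES
`σ(S, p) := (A'_(p,|S|)) (row S) (col (S + p))`, `p ∉ S` (`weightE_eq_one_iff`); evaluating the block
identity (`grenet_tangency_weightSplit`) at the PERMUTATION POINTS `x_{j,c} := [π c = j]` — where the
lattice-path matrix has `W ∅ S = [S = π({i<|S|})]` and `W S univ = 1` on prefix sets
(`evalPerm_grenet_W_empty`, `evalPerm_grenet_W_univ`) — gives `Σ_c σ(π{<c}, π c) = 0` for every
ordering `π` of `Fin n`, i.e. zero holonomy along every maximal chain of the Boolean lattice, so the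
arc entries are a coboundary: `σ(S, p) = φ(S + p) - φ(S)`, `φ ∅ = φ univ = 0`
(`grenet_arcEntries_eq_potential`, via `exists_addPotential_of_sum_prefix_eq_zero` of the companion file
`…AddPotential`, val-width-21029-p1).  This is the diagonal `P_SS = Q_SS = φ S` of the gauge pair in
the assembly step (`grenet_gauge_of_pairFunctions`).

No new definitions.  VP ≠ VNP is not moved by this file (first-order bookkeeping about one matrix
family).
-/

noncomputable section

open MvPolynomial Matrix Finset

namespace Summit.ValiantsHypothesis.Theorems.RigidityForcesSymmetry.GrenetGauge

open Literature.Computability.AlgebraicComplexity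

/-! ### Evaluating the lattice-path matrix at a permutation point -/

section EvalPerm

variable (k : Type*) [CommRing k] {n : ℕ}

/-- Evaluation of an arc weight: `wt j c ↦ D (j, c)` (`c < n`). [cite: Grenet2011, Thm. 1] -/
theorem eval_grenet_wt (D : Fin n × Fin n → k) (j : Fin n) (c : ℕ) :
    eval D (Grenet.wt k n j c) = if h : c < n then D (j, ⟨c, h⟩) else 0 := by
  unfold Grenet.wt
  split_ifs with h
  · exact eval_X _
  · exact map_zero _

/-- Evaluation of a power of Grenet's adjacency matrix: the sum over the injective sequences of the
products of the evaluated arc weights. [cite: Grenet2012Thesis, Lemme 3.17] -/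
theorem eval_grenet_adj_pow (D : Fin n × Fin n → k) (m : ℕ) (S T : Finset (Fin n)) :
    eval D ((Grenet.adj k n ^ m) S T) = ∑ g : Fin m → Fin n,
      if Function.Injective g ∧ (∀ t, g t ∉ S) ∧ S ∪ univ.image g = T
      then ∏ t : Fin m, eval D (Grenet.wt k n (g t) (S.card + t)) else 0 := by
  rw [Grenet.pow_apply (Grenet.wt k n) (grenet_adj_shape k n), map_sum]
  refine Finset.sum_congr rfl fun g _ => ?_
  split_ifs
  · exact map_prod _ _ _
  · exact map_zero _

/-- An injective sequence avoiding `S` and covering `T` together with `S` has length `|T| - |S|`.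
[folklore] -/
theorem card_eq_of_pathCondition {m : ℕ} {S T : Finset (Fin n)} {g : Fin m → Fin n}
    (hg : Function.Injective g) (hgS : ∀ t, g t ∉ S) (hST : S ∪ univ.image g = T) :
    T.card = S.card + m := by
  rw [← hST, Finset.card_union_of_disjoint (Finset.disjoint_left.mpr fun x hxS hx => by
    obtain ⟨t, -, rfl⟩ := Finset.mem_image.mp hx
    exact hgS t hxS), Finset.card_image_of_injective _ hg, Finset.card_univ, Fintype.card_fin]

/-- The image of the shifted permutation sequence `t ↦ π (s + t)` (`t < m`, `s + m ≤ n`) is the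
slice `π({s ≤ i < s + m})`. [folklore] -/
theorem image_perm_shift (π : Equiv.Perm (Fin n)) {s m : ℕ} (hsm : s + m ≤ n) :
    univ.image (fun t : Fin m => π ⟨s + (t : ℕ), by omega⟩)
      = (univ.filter fun i : Fin n => s ≤ (i : ℕ) ∧ (i : ℕ) < s + m).image π := by
  ext x
  simp only [Finset.mem_image, Finset.mem_univ, true_and, Finset.mem_filter]
  constructor
  · rintro ⟨t, rfl⟩
    exact ⟨⟨s + (t : ℕ), by omega⟩, ⟨by simp, by simp⟩, rfl⟩
  · rintro ⟨i, ⟨h1, h2⟩, rfl⟩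
    exact ⟨⟨(i : ℕ) - s, by omega⟩, by congr 1; ext; simp only; omega⟩

/-- **Powers of the adjacency matrix at a permutation point.**  At `x_{j,c} := [π c = j]` only the
arcs `π({i<c}) → π({i<c+1})`... more generally only the steps `S → S + π(|S|+t)` survive: for
`|S| + m ≤ n`, `eval ((adj ^ m) S T) = [π({|S| ≤ i < |S|+m}) avoids S and S ∪ π({|S| ≤ i < |S|+m}) = T]`.
[folklore] -/
theorem evalPerm_grenet_adj_pow (π : Equiv.Perm (Fin n)) {m : ℕ} (S T : Finset (Fin n))
    (hsm : S.card + m ≤ n) :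
    eval (fun v : Fin n × Fin n => if π v.2 = v.1 then (1 : k) else 0) ((Grenet.adj k n ^ m) S T)
      = if (∀ t : Fin m, π ⟨S.card + (t : ℕ), by omega⟩ ∉ S) ∧
            S ∪ (univ.filter fun i : Fin n => S.card ≤ (i : ℕ) ∧ (i : ℕ) < S.card + m).image π = T
        then 1 else 0 := by
  rw [eval_grenet_adj_pow]
  set g₀ : Fin m → Fin n := fun t => π ⟨S.card + (t : ℕ), by omega⟩ with hg₀
  have hterm : ∀ g : Fin m → Fin n,
      (∏ t : Fin m, eval (fun v : Fin n × Fin n => if π v.2 = v.1 then (1 : k) else 0)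
        (Grenet.wt k n (g t) (S.card + t))) = if g = g₀ then 1 else 0 := by
    intro g
    have h1 : ∀ t : Fin m, eval (fun v : Fin n × Fin n => if π v.2 = v.1 then (1 : k) else 0)
        (Grenet.wt k n (g t) (S.card + t)) = if g₀ t = g t then 1 else 0 := fun t => by
      rw [eval_grenet_wt, dif_pos (by omega)]
    simp_rw [h1]
    rw [Fintype.prod_boole]
    by_cases hg : g = g₀
    · rw [if_pos hg, if_pos fun t => by rw [hg]]
    · rw [if_neg hg, if_neg fun h => hg (funext fun t => (h t).symm)]
  simp_rw [hterm]
  rw [Finset.sum_eq_single_of_mem g₀ (Finset.mem_univ _) fun g _ hg => by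
    rw [if_neg hg]; split_ifs <;> rfl]
  rw [if_pos rfl]
  have hinj : Function.Injective g₀ := fun t₁ t₂ h => by
    have := Fin.mk.inj_iff.mp (π.injective h)
    exact Fin.ext (by omega)
  have himg : univ.image g₀ = (univ.filter fun i : Fin n => S.card ≤ (i : ℕ) ∧ (i : ℕ) < S.card + m).image π :=
    image_perm_shift π hsm
  by_cases hc : (∀ t : Fin m, π ⟨S.card + (t : ℕ), by omega⟩ ∉ S) ∧
      S ∪ (univ.filter fun i : Fin n => S.card ≤ (i : ℕ) ∧ (i : ℕ) < S.card + m).image π = T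
  · rw [if_pos hc, if_pos ⟨hinj, hc.1, by rw [himg]; exact hc.2⟩]
  · rw [if_neg hc, if_neg]
    rintro ⟨-, h2, h3⟩
    rw [himg] at h3
    exact hc ⟨h2, h3⟩

/-- **The source column of the path matrix at a permutation point**: `eval (W ∅ S) = [S = π({i < |S|})]`
(the unique surviving path from `∅` visits the prefix sets of `π`). [folklore] -/
theorem evalPerm_grenet_W_empty (π : Equiv.Perm (Fin n)) (S : Finset (Fin n)) :
    eval (fun v : Fin n × Fin n => if π v.2 = v.1 then (1 : k) else 0) ((1 - Grenet.adj k n).adjugate ∅ S)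
      = if (univ.filter fun i : Fin n => (i : ℕ) < S.card).image π = S then 1 else 0 := by
  have hSn : S.card ≤ n := (Finset.card_le_univ S).trans_eq (Fintype.card_fin n)
  rw [Grenet.adjugate_one_sub (Grenet.wt k n) (grenet_adj_shape k n), Matrix.sum_apply, map_sum]
  have hm : ∀ m ∈ range (n + 1), eval (fun v : Fin n × Fin n => if π v.2 = v.1 then (1 : k) else 0)
      ((Grenet.adj k n ^ m) ∅ S)
      = if m = S.card ∧ (univ.filter fun i : Fin n => (i : ℕ) < S.card).image π = S then 1 else 0 := by
    intro m hm
    have hmn : m ≤ n := Nat.lt_succ_iff.mp (Finset.mem_range.mp hm)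
    rw [evalPerm_grenet_adj_pow k π ∅ S (by rw [Finset.card_empty]; omega)]
    simp only [Finset.card_empty, Finset.notMem_empty, not_false_eq_true, implies_true, true_and,
      Finset.empty_union, zero_le, zero_add]
    by_cases h : (univ.filter fun i : Fin n => (i : ℕ) < m).image π = S
    · have hmS : m = S.card := by rw [← h, Grenet.card_prefix_image π hmn]
      subst hmS
      rw [if_pos h, if_pos ⟨rfl, h⟩]
    · rw [if_neg h, if_neg]
      rintro ⟨rfl, h'⟩
      exact h h'
  rw [Finset.sum_congr rfl hm, Finset.sum_ite, Finset.sum_const_zero, add_zero, Finset.sum_const,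
    nsmul_eq_mul, mul_one]
  by_cases h : (univ.filter fun i : Fin n => (i : ℕ) < S.card).image π = S
  · rw [if_pos h]
    have : (range (n + 1)).filter (fun m => m = S.card ∧
        (univ.filter fun i : Fin n => (i : ℕ) < S.card).image π = S) = {S.card} := by
      ext m
      simp only [Finset.mem_filter, Finset.mem_range, Finset.mem_singleton, h, and_true]
      constructor
      · exact fun h' => h'.2
      · rintro rfl; exact ⟨by omega, rfl⟩
    rw [this, Finset.card_singleton, Nat.cast_one]
  · rw [if_neg h]
    have : (range (n + 1)).filter (fun m => m = S.card ∧
        (univ.filter fun i : Fin n => (i : ℕ) < S.card).image π = S) = ∅ :=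
      Finset.filter_false_of_mem fun m _ h' => h h'.2
    rw [this, Finset.card_empty, Nat.cast_zero]

/-- **The sink row of the path matrix at a permutation point**: if `S = π({i < |S|})` is a prefix set
then `eval (W S univ) = 1` (the unique surviving path continues along `π`). [folklore] -/
theorem evalPerm_grenet_W_univ (π : Equiv.Perm (Fin n)) {S : Finset (Fin n)}
    (hS : (univ.filter fun i : Fin n => (i : ℕ) < S.card).image π = S) :
    eval (fun v : Fin n × Fin n => if π v.2 = v.1 then (1 : k) else 0) ((1 - Grenet.adj k n).adjugate S univ) = 1 := by
  have hSn : S.card ≤ n := (Finset.card_le_univ S).trans_eq (Fintype.card_fin n)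
  rw [Grenet.adjugate_one_sub (Grenet.wt k n) (grenet_adj_shape k n), Matrix.sum_apply, map_sum,
    Finset.sum_eq_single_of_mem (n - S.card) (Finset.mem_range.mpr (by omega))]
  · rw [evalPerm_grenet_adj_pow k π S univ (by omega), if_pos]
    constructor
    · intro t ht
      have ht' : π ⟨S.card + (t : ℕ), by omega⟩ ∈ (univ.filter fun i : Fin n => (i : ℕ) < S.card).image π := by
        rw [hS]; exact ht
      rw [Grenet.mem_prefix_image, Equiv.symm_apply_apply] at ht'
      simp only at ht'
      omega
    · apply Finset.eq_univ_of_forall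
      intro x
      rw [Finset.mem_union]
      by_cases hx : ((π.symm x : Fin n) : ℕ) < S.card
      · left
        rw [← hS]
        exact (Grenet.mem_prefix_image π _ x).mpr hx
      · right
        rw [Finset.mem_image]
        refine ⟨π.symm x, ?_, π.apply_symm_apply x⟩
        simp only [Finset.mem_filter, Finset.mem_univ, true_and]
        have := (π.symm x).isLt
        omega
  · intro m hm hne
    rw [eval_grenet_adj_pow]
    refine Finset.sum_eq_zero fun g _ => if_neg ?_
    rintro ⟨hg, hgS, hST⟩
    have h := card_eq_of_pathCondition hg hgS hST
    rw [Finset.card_univ, Fintype.card_fin] at h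
    exact hne (by omega)

/-- No path runs against the inclusion order: `W T S = 0` unless `T ⊆ S`. [folklore] -/
theorem grenet_W_eq_zero_of_not_subset {S T : Finset (Fin n)} (h : ¬ T ⊆ S) :
    (1 - Grenet.adj k n).adjugate T S = 0 := by
  rw [Grenet.adjugate_one_sub (Grenet.wt k n) (grenet_adj_shape k n), Matrix.sum_apply]
  refine Finset.sum_eq_zero fun m _ => ?_
  rw [Grenet.pow_apply (Grenet.wt k n) (grenet_adj_shape k n)]
  refine Finset.sum_eq_zero fun g _ => if_neg ?_
  rintro ⟨-, -, h'⟩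
  exact h (h' ▸ Finset.subset_union_left)

end EvalPerm

/-! ### The arc entries of a tangent direction are a potential difference -/

section ArcEntries

variable {k : Type*} [CommRing k] [IsDomain k] {n N : ℕ} (e : Finset (Fin n) ≃ Fin (N + 1))

/-- **Block W0 of the blueprint: the arc entries are a coboundary.**  If the homogeneous direction
`Σ_v x_v A'_v` is Zariski-tangent at Grenet's pencil (`tr(adj(x̃) · Σ_v x_v A'_v) = 0`), then there is
a potential `φ` on the vertices, `φ ∅ = φ univ = 0`, such that every ARC ENTRY is a potential
difference: `(A'_(p,|S|)) (row S) (col (S + p)) = φ (S + p) - φ S` for all `p ∉ S`.  (Weight-zero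
block of `grenet_tangency_weightSplit` for the indicator weights, evaluated at the permutation points
`x_{j,c} := [π c = j]`: every maximal chain has entry sum `0`; then `exists_addPotential_of_sum_prefix_eq_zero`.)
[cite: Grenet2011, Thm. 1] -/
theorem grenet_arcEntries_eq_potential (hn : n ≠ 0) (hN : 2 ^ n = N + 1)
    (A' : Fin n × Fin n → Matrix (Fin N) (Fin N) k)
    (htr : ((Grenet.repr k n e).adjugate * ∑ v, (X v : MvPolynomial (Fin n × Fin n) k) • (A' v).map C).trace = 0) :
    ∃ φ : Finset (Fin n) → k, φ ∅ = 0 ∧ φ univ = 0 ∧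
      ∀ (v : Fin n × Fin n) (i j : Fin N), v.1 ∉ e.symm ((e univ).succAbove i) →
        (v.2 : ℕ) = (e.symm ((e univ).succAbove i)).card →
        e.symm ((e ∅).succAbove j) = insert v.1 (e.symm ((e univ).succAbove i)) →
        A' v i j = φ (e.symm ((e ∅).succAbove j)) - φ (e.symm ((e univ).succAbove i)) := by
  classical
  -- indices of vertices
  have hNpos : 0 < N := by
    have h1 : 2 ≤ 2 ^ n := Nat.le_self_pow hn 2
    omega
  haveI : Nonempty (Fin N) := ⟨⟨0, hNpos⟩⟩
  choose! ri hri using fun (S : Finset (Fin n)) (hS : S ≠ univ) => exists_grenet_row_eq e hS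
  choose! ci hci using fun (T : Finset (Fin n)) (hT : T ≠ ∅) => exists_grenet_col_eq e hT
  have hRinj : ∀ i i' : Fin N, e.symm ((e univ).succAbove i) = e.symm ((e univ).succAbove i') → i = i' :=
    fun i i' h => Fin.succAbove_right_injective (e.symm.injective h)
  have hCinj : ∀ j j' : Fin N, e.symm ((e ∅).succAbove j) = e.symm ((e ∅).succAbove j') → j = j' :=
    fun j j' h => Fin.succAbove_right_injective (e.symm.injective h)
  have hri' : ∀ i : Fin N, ri (e.symm ((e univ).succAbove i)) = i :=
    fun i => hRinj _ _ (hri _ (grenet_row_ne_univ e i))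
  have hci' : ∀ j : Fin N, ci (e.symm ((e ∅).succAbove j)) = j :=
    fun j => hCinj _ _ (hci _ (grenet_col_ne_empty e j))
  -- the 1-cochain of arc entries
  set σ : Finset (Fin n) → Fin n → k := fun S p =>
    if h : S.card < n then A' (p, ⟨S.card, h⟩) (ri S) (ci (insert p S)) else 0 with hσ_def
  -- the weight-zero block of the tangency identity
  have hblock := grenet_tangency_weightSplit e (fun j => (Pi.single (Sum.inl j) 1 : Fin n ⊕ Fin n → ℕ))
    (fun c => (Pi.single (Sum.inr c) 1 : Fin n ⊕ Fin n → ℕ)) hn hN A' htr (fun _ => 1)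
  rw [Finset.filter_congr fun x _ => weightE_eq_one_iff (e.symm ((e univ).succAbove x.1))
    (e.symm ((e ∅).succAbove x.2.1)) x.2.2] at hblock
  -- chain sums
  have hchain : ∀ π : Equiv.Perm (Fin n),
      ∑ t : Fin n, σ ((univ.filter fun i : Fin n => (i : ℕ) < (t : ℕ)).image π) (π t) = 0 := by
    intro π
    have h := congrArg (eval (fun v : Fin n × Fin n => if π v.2 = v.1 then (1 : k) else 0)) hblock
    rw [map_sum, map_zero] at h
    -- each term of the block evaluates to `-(entry) · [R i = π({< |R i|}) ∧ π v.2 = v.1]`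
    have hterm : ∀ x ∈ (univ : Finset (Fin N × Fin N × (Fin n × Fin n))).filter (fun x =>
        x.2.2.1 ∉ e.symm ((e univ).succAbove x.1) ∧
          e.symm ((e ∅).succAbove x.2.1) = insert x.2.2.1 (e.symm ((e univ).succAbove x.1)) ∧
          (x.2.2.2 : ℕ) = (e.symm ((e univ).succAbove x.1)).card),
        eval (fun v : Fin n × Fin n => if π v.2 = v.1 then (1 : k) else 0)
          (C (A' x.2.2 x.1 x.2.1) *
            (perPoly (Fin n) k * (1 - Grenet.adj k n).adjugate (e.symm ((e ∅).succAbove x.2.1))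
                (e.symm ((e univ).succAbove x.1)) * X x.2.2
              - (1 - Grenet.adj k n).adjugate ∅ (e.symm ((e univ).succAbove x.1)) * X x.2.2
                * (1 - Grenet.adj k n).adjugate (e.symm ((e ∅).succAbove x.2.1)) univ))
          = -(A' x.2.2 x.1 x.2.1 *
              if (univ.filter fun i' : Fin n => (i' : ℕ) < (e.symm ((e univ).succAbove x.1)).card).image π
                  = e.symm ((e univ).succAbove x.1) ∧ π x.2.2.2 = x.2.2.1 then 1 else 0) := by
      intro x hx
      obtain ⟨hx1, hx2, hx3⟩ := (Finset.mem_filter.mp hx).2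
      have hns : ¬ e.symm ((e ∅).succAbove x.2.1) ⊆ e.symm ((e univ).succAbove x.1) := fun hsub =>
        hx1 (hsub (hx2 ▸ Finset.mem_insert_self _ _))
      rw [map_mul, eval_C, map_sub, map_mul, map_mul, map_mul, map_mul,
        grenet_W_eq_zero_of_not_subset k hns, map_zero, mul_zero, zero_mul, zero_sub,
        evalPerm_grenet_W_empty, eval_X, mul_neg]
      by_cases hP : (univ.filter fun i' : Fin n => (i' : ℕ) < (e.symm ((e univ).succAbove x.1)).card).image π
          = e.symm ((e univ).succAbove x.1) ∧ π x.2.2.2 = x.2.2.1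
      · have hpre : (univ.filter fun i' : Fin n => (i' : ℕ) < (e.symm ((e ∅).succAbove x.2.1)).card).image π
            = e.symm ((e ∅).succAbove x.2.1) := by
          have hlt : (e.symm ((e univ).succAbove x.1)).card < n := hx3 ▸ x.2.2.2.isLt
          rw [hx2, Finset.card_insert_of_notMem hx1, Grenet.prefix_image_succ π hlt, hP.1]
          congr 1
          rw [← hP.2]
          congr 1
          exact Fin.ext hx3.symm
        rw [if_pos hP.1, if_pos hP.2, if_pos hP, evalPerm_grenet_W_univ k π hpre]
        simp
      · rw [if_neg hP]
        rcases not_and_or.mp hP with h' | h'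
        · rw [if_neg h']; simp
        · rw [if_neg h']; simp
    rw [Finset.sum_congr rfl hterm, Finset.sum_neg_distrib, neg_eq_zero] at h
    rw [← h]
    -- reindex: the surviving terms are the arcs of the chain of `π`
    have hpre_card : ∀ t : Fin n, ((univ.filter fun i : Fin n => (i : ℕ) < (t : ℕ)).image π).card = t :=
      fun t => Grenet.card_prefix_image π t.isLt.le
    have hpre_ne : ∀ t : Fin n, (univ.filter fun i : Fin n => (i : ℕ) < (t : ℕ)).image π ≠ univ := fun t h => by
      have := hpre_card t
      rw [h, Finset.card_univ, Fintype.card_fin] at this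
      exact absurd this (ne_of_gt t.isLt)
    set ξ : Fin n → Fin N × Fin N × (Fin n × Fin n) := fun t =>
      (ri ((univ.filter fun i : Fin n => (i : ℕ) < (t : ℕ)).image π),
        ci (insert (π t) ((univ.filter fun i : Fin n => (i : ℕ) < (t : ℕ)).image π)), (π t, t)) with hξ_def
    have hξinj : Function.Injective ξ := fun t t' h => by
      have := congrArg (fun x => x.2.2.2) h
      exact this
    have hξR : ∀ t : Fin n, e.symm ((e univ).succAbove (ξ t).1) = (univ.filter fun i : Fin n => (i : ℕ) < (t : ℕ)).image π :=
      fun t => hri _ (hpre_ne t)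
    have hξC : ∀ t : Fin n, e.symm ((e ∅).succAbove (ξ t).2.1) =
        insert (π t) ((univ.filter fun i : Fin n => (i : ℕ) < (t : ℕ)).image π) :=
      fun t => hci _ (Finset.insert_ne_empty _ _)
    symm
    rw [← Finset.sum_subset (s₁ := univ.image ξ)]
    · rw [Finset.sum_image fun t _ t' _ h => hξinj h]
      refine Finset.sum_congr rfl fun t _ => ?_
      rw [hξR, if_pos ⟨by rw [hpre_card], rfl⟩, mul_one, hσ_def]
      simp only
      rw [dif_pos (by rw [hpre_card]; exact t.isLt)]
      congr 2
      exact Prod.ext rfl (Fin.ext (hpre_card t).symm)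
    · intro x hx
      obtain ⟨t, -, rfl⟩ := Finset.mem_image.mp hx
      refine Finset.mem_filter.mpr ⟨Finset.mem_univ _, ?_, ?_, ?_⟩
      · rw [hξR]
        exact Grenet.not_mem_prefix_image_self π t
      · rw [hξC, hξR]
      · rw [hξR, hpre_card]
    · intro x hx hxi
      obtain ⟨hx1, hx2, hx3⟩ := (Finset.mem_filter.mp hx).2
      rw [mul_eq_zero]
      right
      refine if_neg fun hP => hxi ?_
      rw [Finset.mem_image]
      refine ⟨x.2.2.2, Finset.mem_univ _, ?_⟩
      have ht : (univ.filter fun i : Fin n => (i : ℕ) < ((x.2.2.2 : Fin n) : ℕ)).image π = e.symm ((e univ).succAbove x.1) := by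
        rw [hx3]; exact hP.1
      obtain ⟨i, j, v⟩ := x
      simp only at hx1 hx2 hx3 hP ht ⊢
      refine Prod.ext ?_ (Prod.ext ?_ ?_)
      · simp only [hξ_def, ht, hri']
      · simp only [hξ_def, ht, hP.2, ← hx2, hci']
      · simp only [hξ_def]
        exact Prod.ext hP.2 rfl
  -- the potential
  obtain ⟨φ, h0, huniv, hφ⟩ := exists_addPotential_of_sum_prefix_eq_zero σ hchain
  refine ⟨φ, h0, huniv, fun v i j hv1 hv2 hCj => ?_⟩
  rw [hCj, ← hφ _ _ hv1, hσ_def]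
  simp only
  rw [dif_pos (hv2 ▸ v.2.isLt), hri', ← hCj, hci']
  congr 1
  exact Prod.ext rfl (Fin.ext hv2)

end ArcEntries




end Summit.ValiantsHypothesis.Theorems.RigidityForcesSymmetry.GrenetGauge
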